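import Mathlib
import Literature.NumberTheory.Automorphic.ToricPseudoEisensteinSeries
import HarnessLib

/-!
# Toric pseudo-Eisenstein series: the truncated series equals the coset sum of full torus integrals

Topic `NumberTheory/Automorphic`; namespace `Literature.NumberTheory.Automorphic.PseudoEisenstein`
(continued from `ToricPseudoEisensteinSeries`).

In the literature the pseudo-Eisenstein series attached to a subgroup `H ≤ G`, a lattice `Γ` and a
function `φ` on `G` compactly supported modulo `H` (and left-`(Γ_H, χ)`-equivariant) is the COSET sum
`Ψ_φ(g) = Σ_{γ ∈ Γ_H\Γ} φ(γ g)`, `Γ_H = Γ ∩ H` [Garrett2018, §1.8], [MoeglinWaldspurger1995, II.1.10].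
The model of `ToricPseudoEisensteinSeries` instead sums the `β`-TRUNCATED transform
`Ξ_β(y) = ∫_T β χ · f(jT(·)⁻¹ y) dν` over ALL of `Γ` (`Eis`), where `β` is a continuous compactly
supported weight on `T`. This file proves that the two agree as soon as `β ≥ 0` is a
`Γ_T`-partition of unity (`Σ_{δ ∈ Γ_T} β(δ t) = 1` — such a `β` exists exactly because `Γ_T\T` is
compact, `Literature.MeasureTheory.Group.CocompactPartitionOfUnity`), `χ` is left-`Γ_T`-invariant
and `jT : T → G` is proper:

* `hasCompactSupport_torusIntegrand` : the integrand `t ↦ χ(t) f(jT(t)⁻¹ y)` of the full torus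
  integral is compactly supported ("`f` compactly supported modulo `T`", read on `T`);
* `Xi_eq_tsum_Xiβ` : `Ξ^χ_f(y) = Σ_{δ ∈ Γ_T} Ξ_β(jT(δ)⁻¹ y)` — the full torus integral is the
  `Γ_T`-periodisation of the truncated one (partition of unity + `integral_tsum`);
* `Eis_eq_cosetSum` : for any system of representatives `s : Q → G` of `Γ_T\Γ` (an equivalence
  `Γ_T × Q ≃ Γ`, `(δ, q) ↦ jT(δ) s(q)`), `Σ_{q} Ξ^χ_f(s(q) y) = Eis … y` — the coset sum of the FULL
  torus integrals equals the sum over all of `Γ` of the truncated ones (a regrouping of a finitely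
  supported sum, `Eis_support_finite`).

So every statement about `Eis` in `ToricPseudoEisensteinSeries` / `ToricPseudoEisensteinUnfolding`
is a statement about the pseudo-Eisenstein series of the literature.

Provenance: HodgeCM PerL cell `pub-hodgecm`, package file `HodgeCM/PerL34/PseudoEisenstein.lean`
(seat pv15, gate run 20), section `Fidelity`, ported to the tree under the LEAN-IN-TREE rule by seat
pv15-g7 (names `HodgeCM.PerL34.N23a.X` ↦ `Literature.NumberTheory.Automorphic.PseudoEisenstein.X`,
statements verbatim).

## References

* P. Garrett, *Modern Analysis of Automorphic Forms by Example*, vol. 1 (2018), §1.8 [Garrett2018].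
* C. Moeglin, J.-L. Waldspurger, *Spectral Decomposition and Eisenstein Series* (1995), II.1.10
  [MoeglinWaldspurger1995].
* A. Deitmar, S. Echterhoff, *Principles of Harmonic Analysis*, 2nd ed. (2014), §1.5 (the quotient
  integral formula `∫_G f = ∫_{H\G} ∫_H f(hx) dh dx`, Thm 1.5.3) [DeitmarEchterhoff2014].
-/

noncomputable section

open _root_.MeasureTheory Set Filter Function
open scoped Pointwise ENNReal

namespace Literature.NumberTheory.Automorphic

namespace PseudoEisenstein

/-! ## Fidelity: the full torus integral `Ξ^χ_f` versus the truncated `Ξ_β` -/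

section Fidelity

variable {G : Type*} [Group G] [TopologicalSpace G] [IsTopologicalGroup G]
  {T : Type*} [Group T] [TopologicalSpace T] [IsTopologicalGroup T]
  [MeasurableSpace T] [BorelSpace T]

omit [MeasurableSpace T] [BorelSpace T] in
/-- The integrand `t ↦ χ(t) f(jT(t)⁻¹ y)` of the full torus integral has compact support when
`jT : T → G` is proper (e.g. a closed embedding) and `f ∈ C_c(G)`: "`f` is compactly supported
modulo `T`", read on `T`. [cite: DeitmarEchterhoff2014, §1.5] -/
theorem hasCompactSupport_torusIntegrand (jT : T →* G)
    (hprop : ∀ C : Set G, IsCompact C → IsCompact ((jT : T → G) ⁻¹' C))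
    (χ : T → ℂ) (f : G → ℂ) (hfs : HasCompactSupport f) (y : G) :
    HasCompactSupport fun t : T => χ t * f ((jT t)⁻¹ * y) := by
  have hC : IsCompact ((jT : T → G) ⁻¹' ((fun x : G => y * x⁻¹) '' tsupport f)) :=
    hprop _ (hfs.isCompact.image (continuous_const.mul continuous_inv))
  apply HasCompactSupport.intro hC
  intro t ht
  have hf0 : f ((jT t)⁻¹ * y) = 0 := by
    apply image_eq_zero_of_notMem_tsupport
    intro hmem
    apply ht
    refine ⟨(jT t)⁻¹ * y, hmem, ?_⟩
    simp
  simp [hf0]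

/-- **Periodisation.** If `Γ_T ≤ T` is a countable subgroup, `χ` is left-`Γ_T`-invariant (a
character of `Γ_T\T`) and `β ≥ 0` is a continuous `Γ_T`-partition of unity (`Σ_δ β(δ t) = 1`, which
is where compactness of `Γ_T\T` enters), then the full torus integral is the `Γ_T`-periodisation of
the truncated transform: `Ξ^χ_f(y) = Σ_{δ ∈ Γ_T} Ξ_β(jT(δ)⁻¹ y)`. Hence, regrouping the locally finite
sum `Σ_{γ ∈ Γ} Ξ_β(γ y)` along the cosets `jT(Γ_T) γ` (for `jT(Γ_T) ≤ Γ`), `Eis` is the coset sum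
`Σ_{γ ∈ Γ_T\Γ} Ξ^χ_f(γ y)` of the literature (`Eis_eq_cosetSum`).
[cite: DeitmarEchterhoff2014, Thm 1.5.3] -/
theorem Xi_eq_tsum_Xiβ (ν : Measure T) [ν.IsMulLeftInvariant] [IsFiniteMeasureOnCompacts ν]
    (jT : T →* G) (hjT : Continuous jT)
    (hprop : ∀ C : Set G, IsCompact C → IsCompact ((jT : T → G) ⁻¹' C))
    (β : T → ℝ) (hβ : Continuous β) (hβnn : ∀ t, 0 ≤ β t)
    (ΓT : Subgroup T) [Countable ΓT]
    (hβsum : ∀ t, HasSum (fun δ : ΓT => β ((δ : T) * t)) 1)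
    (χ : T → ℂ) (hχ : Continuous χ) (hχinv : ∀ (δ : ΓT) (t : T), χ ((δ : T) * t) = χ t)
    (f : G → ℂ) (hf : Continuous f) (hfs : HasCompactSupport f) (y : G) :
    Xi ν jT χ f y = ∑' δ : ΓT, Xiβ ν jT β χ f ((jT δ)⁻¹ * y) := by
  -- the integrand of the full torus integral `Ξ` and its integrability
  set g : T → ℂ := fun s => χ s * f ((jT s)⁻¹ * y) with hg
  have hgc : Continuous g := hχ.mul (hf.comp ((hjT.inv).mul continuous_const))
  have hgs : HasCompactSupport g := hasCompactSupport_torusIntegrand jT hprop χ f hfs y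
  have hgi : Integrable g ν := hgc.integrable_of_hasCompactSupport hgs
  -- partition of unity, reindexed by inversion
  have hsum' : ∀ s : T, HasSum (fun δ : ΓT => β ((δ : T)⁻¹ * s)) 1 := by
    intro s
    have h := (hβsum s)
    rw [← (Equiv.inv ΓT).hasSum_iff] at h
    simpa only [Equiv.inv_apply, Function.comp_def, Subgroup.coe_inv] using h
  -- (i) each term, after the substitution `t = δ⁻¹ s`
  have hterm : ∀ δ : ΓT,
      Xiβ ν jT β χ f ((jT δ)⁻¹ * y) = ∫ s, (β ((δ : T)⁻¹ * s) : ℂ) * g s ∂ν := by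
    intro δ
    rw [← integral_mul_left_eq_self (fun s => (β ((δ : T)⁻¹ * s) : ℂ) * g s) (δ : T)]
    unfold Xiβ wt
    congr 1
    ext t
    simp only [hg, inv_mul_cancel_left, map_mul, mul_inv_rev, hχinv, mul_assoc]
  simp_rw [hterm]
  -- (ii) interchange sum and integral
  have hmeas : ∀ δ : ΓT, AEStronglyMeasurable (fun s => (β ((δ : T)⁻¹ * s) : ℂ) * g s) ν := by
    intro δ
    exact ((Complex.continuous_ofReal.comp (hβ.comp (continuous_const.mul continuous_id))).mul
      hgc).aestronglyMeasurable
  have hpt : ∀ s : T, ∑' δ : ΓT, ‖(β ((δ : T)⁻¹ * s) : ℂ) * g s‖ₑ = ‖g s‖ₑ := by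
    intro s
    have h1 : ∀ δ : ΓT, ‖(β ((δ : T)⁻¹ * s) : ℂ) * g s‖ₑ
        = ENNReal.ofReal (β ((δ : T)⁻¹ * s)) * ‖g s‖ₑ := by
      intro δ
      rw [enorm_mul]
      congr 1
      rw [← ofReal_norm, Complex.norm_real, Real.norm_of_nonneg (hβnn _)]
    simp_rw [h1]
    rw [ENNReal.tsum_mul_right, ← ENNReal.ofReal_tsum_of_nonneg (fun δ => hβnn _) (hsum' s).summable,
      (hsum' s).tsum_eq, ENNReal.ofReal_one, one_mul]
  have hfin : ∑' δ : ΓT, ∫⁻ s, ‖(β ((δ : T)⁻¹ * s) : ℂ) * g s‖ₑ ∂ν ≠ ∞ := by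
    rw [← lintegral_tsum (fun δ => (hmeas δ).enorm)]
    simp_rw [hpt]
    exact hgi.2.ne
  rw [← integral_tsum hmeas hfin]
  -- (iii) the partition of unity sums to one
  unfold Xi
  congr 1
  ext s
  rw [tsum_mul_right, ← Complex.ofReal_tsum, (hsum' s).tsum_eq, Complex.ofReal_one, one_mul]

/-- **The coset sum of the literature equals `Eis`**: `Σ_{γ ∈ Γ_T\Γ} Ξ^χ_f(γ y) = Eis … y`.
Here `s : Q → G` is any system of representatives of the cosets `Γ_T\Γ`: the hypothesis
`e : Γ_T × Q ≃ Γ` with `e(δ, q) = jT(δ) · s(q)` says exactly that `Γ = ⊔_q jT(Γ_T) s(q)` (and that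
`jT : Γ_T → Γ` is injective). Conclusion: the coset sum of the FULL torus integrals equals the sum
over ALL of `Γ` of the truncated ones, i.e. `Eis` — a regrouping of a finitely supported sum
(`Eis_support_finite`) combined with `Xi_eq_tsum_Xiβ`. [cite: Garrett2018, §1.8] -/
theorem Eis_eq_cosetSum [T2Space G] (ν : Measure T) [ν.IsMulLeftInvariant]
    [IsFiniteMeasureOnCompacts ν]
    (jT : T →* G) (hjT : Continuous jT)
    (hprop : ∀ C : Set G, IsCompact C → IsCompact ((jT : T → G) ⁻¹' C))
    (β : T → ℝ) (hβ : Continuous β) (hβs : HasCompactSupport β) (hβnn : ∀ t, 0 ≤ β t)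
    (ΓT : Subgroup T) [Countable ΓT]
    (hβsum : ∀ t, HasSum (fun δ : ΓT => β ((δ : T) * t)) 1)
    (χ : T → ℂ) (hχ : Continuous χ) (hχinv : ∀ (δ : ΓT) (t : T), χ ((δ : T) * t) = χ t)
    (Γ : Subgroup G) (hΓ : DiscreteMeets Γ)
    {Q : Type*} (s : Q → G) (e : ΓT × Q ≃ Γ) (he : ∀ (δ : ΓT) (q : Q), ((e (δ, q) : Γ) : G) = jT δ * s q)
    (f : G → ℂ) (hf : Continuous f) (hfs : HasCompactSupport f) (y : G) :
    ∑' q : Q, Xi ν jT χ f (s q * y) = Eis ν jT β χ Γ f y := by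
  -- the `Γ`-sum has finite support, hence is unconditionally summable, and so is its transport
  set F : Γ → ℂ := fun γ => Xiβ ν jT β χ f ((γ : G) * y) with hF
  have hFfin : (Function.support F).Finite := Eis_support_finite ν jT hjT β hβs χ Γ hΓ f hfs y
  set F' : Q × ΓT → ℂ := fun p => F (e (p.2, p.1)) with hF'
  have hinj : Function.Injective fun p : Q × ΓT => e (p.2, p.1) := by
    intro p₁ p₂ h
    have h' := e.injective h
    simp only [Prod.mk.injEq] at h'
    exact Prod.ext h'.2 h'.1
  have hF'fin : (Function.support F').Finite := by
    have : Function.support F' ⊆ (fun p : Q × ΓT => e (p.2, p.1)) ⁻¹' Function.support F := by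
      intro p hp; exact hp
    exact (hFfin.preimage hinj.injOn).subset this
  have hF's : Summable F' := summable_of_hasFiniteSupport hF'fin
  have hfib : ∀ q : Q, Summable fun δ : ΓT => F' (q, δ) := by
    intro q
    apply summable_of_hasFiniteSupport
    have : Function.support (fun δ : ΓT => F' (q, δ)) ⊆ Prod.snd '' Function.support F' := by
      intro δ hδ
      exact ⟨(q, δ), hδ, rfl⟩
    exact (hF'fin.image Prod.snd).subset this
  -- regroup: Σ_Γ = Σ_q Σ_δ
  have hre : Eis ν jT β χ Γ f y = ∑' p : Q × ΓT, F' p := by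
    unfold Eis
    have h1 : ∑' γ : Γ, F γ = ∑' p : ΓT × Q, F (e p) := (e.tsum_eq F).symm
    have h2 : ∑' p : ΓT × Q, F (e p) = ∑' p : Q × ΓT, F (e (p.2, p.1)) :=
      ((Equiv.prodComm Q ΓT).tsum_eq (fun p : ΓT × Q => F (e p))).symm
    rw [hF'] ; exact h1.trans h2
  rw [hre, hF's.tsum_prod' hfib]
  congr 1
  ext q
  -- inner sum: Σ_δ Ξ_β(jT δ s(q) y) = Ξ(s(q) y) by fidelity, after δ ↦ δ⁻¹
  rw [Xi_eq_tsum_Xiβ ν jT hjT hprop β hβ hβnn ΓT hβsum χ hχ hχinv f hf hfs (s q * y)]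
  rw [← (Equiv.inv ΓT).tsum_eq]
  congr 1
  ext δ
  simp only [hF', hF, he, Equiv.inv_apply, Subgroup.coe_inv, map_inv, inv_inv, mul_assoc]

end Fidelity

end PseudoEisenstein

end Literature.NumberTheory.Automorphic

end
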